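import Literature.Computability.Complexity.BrickAlgebra
import Literature.Computability.Complexity.KannanLanguage
import Literature.Computability.Complexity.CoinTruncation
import Literature.Computability.Complexity.PairTruncation
import Literature.Computability.Complexity.PairPlumbing
import Literature.Computability.Complexity.IterateFP
import HarnessLib

/-!
# Plumbing bricks: unary counters with wrap-around, take/drop/pad, and the unary value of a polynomial

Trunk `CplxCore`, toolkit in the "algebra of `FP` string functions" style of `BrickAlgebra.lean`
(record projections `Brick.fstF`/`sndF`/`nthF`/`sndPow`, `fanoutFn`, `iteFn`, `eqPairFn`, clocked
loops `iterate_mem_FP`). This file adds a few everyday bricks **assembled from existing ones, with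
no new machine and no new transducer** (zeros from `Kannan.zerosFn`, `KannanLanguage.lean`):

* `polyFn Q w = 1^{Q(|w|)}` — the unary pad `OracleCompose.padFn` (`CookReducibilityTransitive.lean`)
  applied to `⟨w, ε⟩`;
* `takeFn ⟨u, z⟩ = z ↾ |u|` (`truncPairFn`, `PairTruncation.lean`) and `dropFn ⟨u, z⟩ = z ⇂ |u|`
  (`dropSndFn`, `CoinTruncation.lean`);
* `pad10Fn ⟨1ᴾ, y⟩ = y 1 0^{P - |y|}` (the `10*`-padding of Goldreich 2001, eq. (2.3), assembled from
  `OracleCompose.concatFn`, `Kannan.zerosFn`, `dropFn`, `onesFn`);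
* the wrap-around successor `wrapSucc ⟨1ᴮ, 1ᵛ⟩` and the clocked counters `modLenFn ⟨1ᴮ, r⟩ = 1^{|r| mod B}`,
  `divModFn ⟨1ᴷ, 1ᵃ⟩ = ⟨1^{a / K}, 1^{a mod K}⟩` (Lean's `a / 0 = 0`, `a mod 0 = a` come out of the same
  loops), with the arithmetic lemmas `mod_succ_eq`, `div_mod_succ`, `true_cons_ones_eq_iff`.

## References

* S. Arora, B. Barak, *Computational Complexity: A Modern Approach*, CUP 2009, §1.3 (closure of
  polynomial time under composition), §1.4.1 (clocked loops), §0.1 (pairing).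
* O. Goldreich, *Foundations of Cryptography I*, CUP 2001, §2.2.3.2, eq. (2.3) (the padding `10*`).
-/

namespace Literature.Computability.Complexity

open _root_.Computability Polynomial Brick OracleCompose

namespace Plumb

/-! ### Small arithmetic on unary words -/

/-- `1 :: 1ᵛ = 1ᴮ ↔ v + 1 = B`. [folklore] -/
theorem true_cons_ones_eq_iff (v B : ℕ) : (true :: ones v = ones B) ↔ v + 1 = B := by
  constructor
  · intro h
    have := congrArg List.length h
    simpa [Nat.add_comm] using this
  · rintro rfl; rfl

/-- Successor modulo `B` (also for `B = 0`). [folklore] -/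
theorem mod_succ_eq (k B : ℕ) : (k + 1) % B = if k % B + 1 = B then 0 else k % B + 1 := by
  rcases Nat.eq_zero_or_pos B with rfl | hB
  · simp
  · have hr := Nat.mod_lt k hB
    have hk : k + 1 = B * (k / B) + (k % B + 1) := by have := Nat.div_add_mod k B; omega
    split_ifs with hc
    · rw [hk, hc, ← Nat.mul_succ, Nat.mul_mod_right]
    · have hlt : k % B + 1 < B := by omega
      rw [hk, Nat.mul_add_mod, Nat.mod_eq_of_lt hlt]

/-- Successor of `(k / K, k mod K)` (also for `K = 0`). [folklore] -/
theorem div_mod_succ (k K : ℕ) :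
    ((k + 1) / K, (k + 1) % K) = if k % K + 1 = K then (k / K + 1, 0) else (k / K, k % K + 1) := by
  rcases Nat.eq_zero_or_pos K with rfl | hK
  · simp
  · have hr := Nat.mod_lt k hK
    have hk : k + 1 = K * (k / K) + (k % K + 1) := by have := Nat.div_add_mod k K; omega
    split_ifs with hc
    · refine Prod.ext ?_ ?_
      · show (k + 1) / K = k / K + 1
        rw [hk, hc, ← Nat.mul_succ, Nat.mul_div_cancel_left _ hK]
      · show (k + 1) % K = 0
        rw [hk, hc, ← Nat.mul_succ, Nat.mul_mod_right]
    · have hlt : k % K + 1 < K := by omega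
      refine Prod.ext ?_ ?_
      · show (k + 1) / K = k / K
        rw [hk, Nat.mul_add_div hK, Nat.div_eq_of_lt hlt, Nat.add_zero]
      · show (k + 1) % K = k % K + 1
        rw [hk, Nat.mul_add_mod, Nat.mod_eq_of_lt hlt]

/-! ### Unary polynomial values, take, drop, `10*`-padding (zeros: `Kannan.zerosFn`) -/

/-- **`polyFn Q w = 1^{Q(|w|)}`**: the unary pad `OracleCompose.padFn Q` on `⟨w, ε⟩`. [folklore] -/
noncomputable def polyFn (Q : Polynomial ℕ) : List Bool → List Bool :=
  OracleCompose.padFn Q ∘ fanoutFn id (fun _ => [])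

/-- **`polyFn Q w = 1^{Q(|w|)}`.** [folklore] -/
@[simp] theorem polyFn_apply (Q : Polynomial ℕ) (w : List Bool) : polyFn Q w = ones (Q.eval w.length) := by
  simp [polyFn, OracleCompose.padFn_apply]

/-- `polyFn Q ∈ FP`. [folklore] -/
theorem polyFn_mem_FP (Q : Polynomial ℕ) : polyFn Q ∈ FP :=
  comp_mem_FP (OracleCompose.padFn_mem_FP Q) (fanoutFn_mem_FP OracleCompose.id_mem_FP (const_mem_FP []))

/-- **`takeFn ⟨u, z⟩ = z ↾ |u|`.** [folklore] -/
noncomputable def takeFn : List Bool → List Bool := sndF ∘ truncPairFn X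

/-- Value of `takeFn` on a pair. [folklore] -/
@[simp] theorem takeFn_boolPair (u z : List Bool) : takeFn (boolPair u z) = z.take u.length := by
  simp [takeFn, sndF]

/-- `takeFn ∈ FP`. [folklore] -/
theorem takeFn_mem_FP : takeFn ∈ FP := comp_mem_FP sndF_mem_FP (truncPairFn_mem_FP X)

/-- **`dropFn ⟨u, z⟩ = z ⇂ |u|`.** [folklore] -/
noncomputable def dropFn : List Bool → List Bool := sndF ∘ dropSndFn X

/-- Value of `dropFn` on a pair. [folklore] -/
@[simp] theorem dropFn_boolPair (u z : List Bool) : dropFn (boolPair u z) = z.drop u.length := by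
  simp [dropFn, dropSndFn_boolPair]

/-- `dropFn ∈ FP`. [folklore] -/
theorem dropFn_mem_FP : dropFn ∈ FP := comp_mem_FP sndF_mem_FP (dropSndFn_mem_FP X)

/-- **`pad10Fn ⟨1ᴾ, y⟩ = y 1 0^{P - |y|}`**: pad `y` with the pattern `10*` to length `P + 1` when
`|y| ≤ P` (junk for `|y| > P`: `ℕ`-subtraction gives `y 1`). [Goldreich 2001, §2.2.3.2, eq. (2.3)]
[cite: Goldreich2001, §2.2.3.2 eq. (2.3)] -/
noncomputable def pad10Fn : List Bool → List Bool :=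
  concatFn ∘ fanoutFn sndF (List.cons true ∘ Kannan.zerosFn ∘ dropFn ∘ fanoutFn (onesFn ∘ sndF) fstF)

/-- Value of `pad10Fn` on `⟨1ᴾ, y⟩`. [folklore] -/
@[simp] theorem pad10Fn_boolPair (P : ℕ) (y : List Bool) :
    pad10Fn (boolPair (ones P) y) = y ++ true :: List.replicate (P - y.length) false := by
  simp [pad10Fn, Kannan.zerosFn_apply, ones, fstF, sndF]

/-- `pad10Fn ∈ FP`. [folklore] -/
theorem pad10Fn_mem_FP : pad10Fn ∈ FP :=
  comp_mem_FP concatFn_mem_FP (fanoutFn_mem_FP sndF_mem_FP (comp_mem_FP (cons_mem_FP true) (comp_mem_FP Kannan.zerosFn_mem_FP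
    (comp_mem_FP dropFn_mem_FP (fanoutFn_mem_FP (comp_mem_FP onesFn_mem_FP sndF_mem_FP) fstF_mem_FP)))))

/-! ### Counting loops: `|r| mod B` and `(a / K, a mod K)` in unary -/

/-- The wrap-around successor of a unary counter `1ᵛ` modulo `1ᴮ` (`B = 0`: plain successor):
`⟨1ᴮ, 1ᵛ⟩ ↦ if v + 1 = B then ε else 1^{v+1}`. [folklore] -/
noncomputable def wrapSucc : List Bool → List Bool :=
  iteFn (eqPairFn ∘ fanoutFn (List.cons true ∘ sndF) fstF) (fun _ => []) (List.cons true ∘ sndF)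

/-- Value of `wrapSucc` on a state. [folklore] -/
theorem wrapSucc_boolPair (B v : ℕ) : wrapSucc (boolPair (ones B) (ones v)) = ones (if v + 1 = B then 0 else v + 1) := by
  unfold wrapSucc
  have hc : (eqPairFn ∘ fanoutFn (List.cons true ∘ sndF) fstF) (boolPair (ones B) (ones v)) = [decide (v + 1 = B)] := by
    simp [eqPairFn_boolPair, true_cons_ones_eq_iff]
  by_cases h : v + 1 = B
  · rw [iteFn_apply_true (by rw [hc, decide_eq_true h]), if_pos h]; rfl
  · rw [iteFn_apply_false (by rw [hc, decide_eq_false h]), if_neg h]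
    simp [List.replicate_succ]

/-- Growth of `wrapSucc`. [folklore] -/
theorem length_wrapSucc_le (w : List Bool) : (wrapSucc w).length ≤ (sndF w).length + 1 := by
  unfold wrapSucc
  rcases eqPairFn_eq_or (fanoutFn (List.cons true ∘ sndF) fstF w) with h | h
  · rw [iteFn_apply_true (by simpa using h)]; simp
  · rw [iteFn_apply_false (by simpa using h)]; simp

/-- `wrapSucc ∈ FP`. [folklore] -/
theorem wrapSucc_mem_FP : wrapSucc ∈ FP :=
  iteFn_mem_FP (comp_mem_FP eqPairFn_mem_FP (fanoutFn_mem_FP (comp_mem_FP (cons_mem_FP true) sndF_mem_FP) fstF_mem_FP))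
    (const_mem_FP []) (comp_mem_FP (cons_mem_FP true) sndF_mem_FP)

/-- One round of `modLenFn` on the state `⟨r, ⟨1ᴮ, 1ᵛ⟩⟩`. [folklore] -/
noncomputable def modRound : List Bool → List Bool := fanoutFn fstF (fanoutFn (nthF 1) (wrapSucc ∘ sndF))

/-- Value of `modRound` on a state. [folklore] -/
theorem modRound_state (r : List Bool) (B v : ℕ) :
    modRound (boolPair r (boolPair (ones B) (ones v))) = boolPair r (boolPair (ones B) (ones (if v + 1 = B then 0 else v + 1))) := by
  simp [modRound, wrapSucc_boolPair, nthF, fstF, sndF]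

/-- Additive growth of `modRound`. [folklore] -/
theorem length_modRound_le (w : List Bool) : (modRound w).length ≤ w.length + 5 := by
  have h1 := length_fstF_sndF_le w
  have h2 := length_fstF_sndF_le (sndF w)
  have h3 := length_wrapSucc_le (sndF w)
  simp only [modRound, fanoutFn_apply, length_boolPair, Function.comp_apply, nthF, fstF, sndF] at h1 h2 h3 ⊢
  omega

/-- `k` rounds of `modRound` count `k mod B`. [folklore] -/
theorem iterate_modRound (r : List Bool) (B : ℕ) : ∀ k,
    modRound^[k] (boolPair r (boolPair (ones B) (ones 0))) = boolPair r (boolPair (ones B) (ones (k % B)))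
  | 0 => by simp
  | k + 1 => by
    rw [Function.iterate_succ_apply', iterate_modRound r B k, modRound_state, ← mod_succ_eq]

/-- **`modLenFn ⟨1ᴮ, r⟩ = 1^{|r| mod B}`** (`|r|` rounds of the wrap-around successor; for `B = 0`
the value is `1^{|r|}`, matching `Nat.mod_zero`). [folklore] -/
noncomputable def modLenFn : List Bool → List Bool :=
  sndPow 1 ∘ (fun w => modRound^[X.eval (boolUnpair w).1.length] w) ∘ fanoutFn sndF (fanoutFn fstF (fun _ => []))

/-- Value of `modLenFn` on `⟨1ᴮ, r⟩`. [folklore] -/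
@[simp] theorem modLenFn_boolPair (B : ℕ) (r : List Bool) : modLenFn (boolPair (ones B) r) = ones (r.length % B) := by
  have h := iterate_modRound r B r.length
  simp only [ones, List.replicate_zero] at h
  simp [modLenFn, ones, h, fstF, sndF, sndPow]

/-- `modLenFn ∈ FP`. [folklore] -/
theorem modLenFn_mem_FP : modLenFn ∈ FP :=
  comp_mem_FP (sndPow_mem_FP 1) (comp_mem_FP
    (iterate_mem_FP (fanoutFn_mem_FP fstF_mem_FP (fanoutFn_mem_FP (nthF_mem_FP 1) (comp_mem_FP wrapSucc_mem_FP sndF_mem_FP)))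
      5 length_modRound_le X)
    (fanoutFn_mem_FP sndF_mem_FP (fanoutFn_mem_FP fstF_mem_FP (const_mem_FP []))))

/-- The carrying counter step on `⟨1ᴷ, ⟨1^q, 1ᵛ⟩⟩`: wrap-around successor of `v` with carry
into `q`. [folklore] -/
noncomputable def divStep : List Bool → List Bool :=
  iteFn (eqPairFn ∘ fanoutFn (List.cons true ∘ sndPow 1) fstF)
    (fanoutFn (List.cons true ∘ nthF 1) (fun _ => []))
    (fanoutFn (nthF 1) (List.cons true ∘ sndPow 1))

/-- Value of `divStep` on a state. [folklore] -/
theorem divStep_boolPair (K q v : ℕ) :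
    divStep (boolPair (ones K) (boolPair (ones q) (ones v))) =
      if v + 1 = K then boolPair (ones (q + 1)) (ones 0) else boolPair (ones q) (ones (v + 1)) := by
  unfold divStep
  have hc : (eqPairFn ∘ fanoutFn (List.cons true ∘ sndPow 1) fstF) (boolPair (ones K) (boolPair (ones q) (ones v))) =
      [decide (v + 1 = K)] := by
    simp [eqPairFn_boolPair, true_cons_ones_eq_iff, sndPow]
  by_cases h : v + 1 = K
  · rw [iteFn_apply_true (by rw [hc, decide_eq_true h]), if_pos h]
    simp [List.replicate_succ, nthF]
  · rw [iteFn_apply_false (by rw [hc, decide_eq_false h]), if_neg h]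
    simp [List.replicate_succ, nthF, sndPow]

/-- Additive growth of `divStep`. [folklore] -/
theorem length_divStep_le (t : List Bool) : (divStep t).length ≤ (sndF t).length + 4 := by
  have h2 := length_fstF_sndF_le (sndF t)
  unfold divStep
  rcases eqPairFn_eq_or (fanoutFn (List.cons true ∘ sndPow 1) fstF t) with h | h
  · rw [iteFn_apply_true (by simpa using h)]
    simp only [fanoutFn_apply, length_boolPair, Function.comp_apply, nthF, fstF, sndF, List.length_cons,
      List.length_nil] at h2 ⊢
    omega
  · rw [iteFn_apply_false (by simpa using h)]
    simp only [fanoutFn_apply, length_boolPair, Function.comp_apply, nthF, sndPow, fstF, sndF, List.length_cons] at h2 ⊢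
    omega

/-- `divStep ∈ FP`. [folklore] -/
theorem divStep_mem_FP : divStep ∈ FP :=
  iteFn_mem_FP (comp_mem_FP eqPairFn_mem_FP (fanoutFn_mem_FP (comp_mem_FP (cons_mem_FP true) (sndPow_mem_FP 1)) fstF_mem_FP))
    (fanoutFn_mem_FP (comp_mem_FP (cons_mem_FP true) (nthF_mem_FP 1)) (const_mem_FP []))
    (fanoutFn_mem_FP (nthF_mem_FP 1) (comp_mem_FP (cons_mem_FP true) (sndPow_mem_FP 1)))

/-- One round of `divModFn` on the state `⟨1ᵃ, ⟨1ᴷ, ⟨1^q, 1ᵛ⟩⟩⟩`. [folklore] -/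
noncomputable def divRound : List Bool → List Bool := fanoutFn fstF (fanoutFn (nthF 1) (divStep ∘ sndF))

/-- Value of `divRound` on a state. [folklore] -/
theorem divRound_state (a K q v : ℕ) :
    divRound (boolPair (ones a) (boolPair (ones K) (boolPair (ones q) (ones v)))) =
      boolPair (ones a) (boolPair (ones K)
        (if v + 1 = K then boolPair (ones (q + 1)) (ones 0) else boolPair (ones q) (ones (v + 1)))) := by
  simp [divRound, divStep_boolPair, nthF, fstF, sndF]

/-- Additive growth of `divRound`. [folklore] -/
theorem length_divRound_le (w : List Bool) : (divRound w).length ≤ w.length + 8 := by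
  have h1 := length_fstF_sndF_le w
  have h2 := length_fstF_sndF_le (sndF w)
  have h3 := length_divStep_le (sndF w)
  simp only [divRound, fanoutFn_apply, length_boolPair, Function.comp_apply, nthF, fstF, sndF] at h1 h2 h3 ⊢
  omega

/-- `k` rounds of `divRound` compute `(k / K, k mod K)`. [folklore] -/
theorem iterate_divRound (a K : ℕ) : ∀ k,
    divRound^[k] (boolPair (ones a) (boolPair (ones K) (boolPair (ones 0) (ones 0)))) =
      boolPair (ones a) (boolPair (ones K) (boolPair (ones (k / K)) (ones (k % K))))
  | 0 => by simp
  | k + 1 => by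
    rw [Function.iterate_succ_apply', iterate_divRound a K k, divRound_state]
    have h := div_mod_succ k K
    split_ifs at h ⊢ with hc
    · simp only [Prod.mk.injEq] at h; rw [h.1, h.2]
    · simp only [Prod.mk.injEq] at h; rw [h.1, h.2]

/-- **`divModFn ⟨1ᴷ, 1ᵃ⟩ = ⟨1^{a / K}, 1^{a mod K}⟩`** (`a` rounds of the carrying counter; for
`K = 0`: `⟨ε, 1ᵃ⟩`, matching `Nat.div_zero`/`Nat.mod_zero`). [folklore] -/
noncomputable def divModFn : List Bool → List Bool :=
  sndPow 1 ∘ (fun w => divRound^[X.eval (boolUnpair w).1.length] w) ∘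
    fanoutFn sndF (fanoutFn fstF (fanoutFn (fun _ => []) (fun _ => [])))

/-- Value of `divModFn` on `⟨1ᴷ, 1ᵃ⟩`. [folklore] -/
@[simp] theorem divModFn_boolPair (K a : ℕ) :
    divModFn (boolPair (ones K) (ones a)) = boolPair (ones (a / K)) (ones (a % K)) := by
  have h := iterate_divRound a K a
  simp only [ones, List.replicate_zero] at h
  simp [divModFn, ones, h, fstF, sndF, sndPow]

/-- `divModFn ∈ FP`. [folklore] -/
theorem divModFn_mem_FP : divModFn ∈ FP := by
  have hround : divRound ∈ FP :=
    fanoutFn_mem_FP fstF_mem_FP (fanoutFn_mem_FP (nthF_mem_FP 1) (comp_mem_FP divStep_mem_FP sndF_mem_FP))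
  exact comp_mem_FP (sndPow_mem_FP 1) (comp_mem_FP (iterate_mem_FP hround 8 length_divRound_le X)
    (fanoutFn_mem_FP sndF_mem_FP (fanoutFn_mem_FP fstF_mem_FP (fanoutFn_mem_FP (const_mem_FP []) (const_mem_FP [])))))

end Plumb

end Literature.Computability.Complexity
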